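import Summits.NavierStokesRegularity.NavierStokesRegularity.Theorems.RellichScarSymmetricScarExistsApexScaleInvariantBoundsLemmas
import Summits.NavierStokesRegularity.NavierStokesRegularity.Theorems.RellichScarSymmetricScarExistsApexRieszPressureBounds
import Mathlib.Analysis.Calculus.ContDiff.Convolution
import Mathlib.Analysis.Calculus.BumpFunction.InnerProduct

/-!
# Crux `SymmetricScarExists` (stmt-NavierStokesRegularity-11718), line `logtime-bernoulli-certificate`:
# stub `stub_apexScaleInvariantBounds` from the time regularity of the Riesz pressure
# (registered sub-goal `stub_apexScaleInvariantBounds_ofRieszSmooth`)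

Helper file (`--supports stmt-NavierStokesRegularity-11718`; theorems only, no definitions, no named
facts).  The registered stub `stub_apexScaleInvariantBounds` (scale-invariant interior regularity of a
classical Type-I solution `(v, q)` of Navier–Stokes on the past, with SOME classical pressure `q'`:
the six bounds `(‖x‖+√(−t))²‖∇v‖, (‖x‖+√(−t))³‖D²v‖, (‖x‖+√(−t))²|q'|, (‖x‖+√(−t))³‖∇q'‖,
(‖x‖+√(−t))³‖∂ₜv‖, (‖x‖+√(−t))⁴‖∇∂ₜv‖ ≤ K`) is assembled here from the landed pieces, conditionally on
ONE analytic input: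

* landed: `stub_apexScaleInvariantBounds_ofPressure` (`…ApexScaleInvariantBoundsLemmas.lean`: the stub
  from its pressure half — velocity bounds at all orders from the tree's
  `PineauVicol2026.exists_forall_iteratedFDeriv_le_of_typeI`, time derivatives from the momentum
  equation) and `apexRieszPressure_scaleInvariantBounds` (`…ApexRieszPressureBounds.lean`: the Riesz
  pressure `Q[v(t)] = pressurePotential (v t)` obeys `(‖x‖+√(−t))²|Q| ≤ K`, `(‖x‖+√(−t))³‖DQ‖ ≤ K`,
  `(‖x‖+√(−t))⁴‖D²Q‖ ≤ K`, `K = K(C)`);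
* the tree's identification `∇q(t) = ∇Q[v(t)]` for classical Type-I solutions
  (`PineauVicol2026.gradient_pressure_eq_of_typeI_vertex`), so that `(v, Q[v])` satisfies the momentum
  equation and is a classical solution as soon as `(t, x) ↦ Q[v(t)](x)` is jointly smooth;
* the hypothesis (NOT in the tree): **joint smoothness in `(t, x)` of the Riesz pressure**
  `(t,x) ↦ Q[v(t)](x)` on `(−∞,0) × ℝ³` for classical Type-I solutions.  Since `Q[v(t)] = q(t,·) − h(t)`
  with `h(t) = q(t,0) − Q[v(t)](0)`, this is the smoothness of ONE function of time,
  `t ↦ Q[v(t)](0)`; it encodes the decay at spatial infinity of all time derivatives of `v` (bounded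
  mild ancient solutions: Koch–Nadirashvili–Seregin–Šverák 2009 §4; differentiation under the integral
  sign in the far potential), which the tree's quantitative regularity (spatial derivatives only) does
  not provide.

`stub_apexScaleInvariantBounds_ofRieszSmooth` (registered sub-goal): that hypothesis implies the stub,
verbatim.  The last section sharpens the residual to ONE explicit parametric integral:
`Q[v(t)](x) = q(t,x) − q(t,0) − Q₁[v(t)](0) − Q₂[v(t)](0)` (`pressurePotential_eq_pressure_sub`), the near
potential `t ↦ Q₁[v(t)](0) = ∫ Γ₀(z) G[v(t)](−z) dz` IS smooth in time (`contDiffOn_nearPotential_zero`,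
Mathlib's convolution with a smooth parameter), so the stub follows from the time regularity of the far
potential at the origin `t ↦ Q₂[v(t)](0) = ∫ D²Γ∞(−y)(v(t,y), v(t,y)) dy` alone
(`stub_apexScaleInvariantBounds_ofFarSmooth`, registered sub-goal) — which is where the decay at spatial
infinity of the time derivatives of `v` is needed.

## References

* G. Seregin, V. Šverák, Comm. PDE 34 (2009) = arXiv:0804.1803, §2 p. 8. [SereginSverak2009]
* B. Pineau, V. Vicol, arXiv:2607.09619 (2026), Lemma 2.1, Lemma 7.1. [PineauVicol2026]
* G. Koch, N. Nadirashvili, G. Seregin, V. Šverák, Acta Math. 203 (2009), §4. [KochNadirashviliSereginSverak2009]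
-/

noncomputable section

open MeasureTheory Set Function Filter Topology Metric
open scoped ContDiff

namespace Summit.NavierStokesRegularity.NavierStokesRegularity.Theorems.SymmetricScarExists.LogtimeBernoulli

open Literature.Analysis.FluidPDE

/-- **The pair `(v, Q[v])` is a classical solution** when the Riesz pressure is jointly smooth: for a
classical Type-I solution `(v, q)` on the past, `∇q(t) = ∇Q[v(t)]`
(`PineauVicol2026.gradient_pressure_eq_of_typeI_vertex`, vertex `(0, 0)`), so the momentum equation holds
with `Q[v(t)]` in place of `q(t)`. [cite: PineauVicol2026, Lemma 2.1 and Lemma 7.1 (proofs, pp. 9–10 and 23–24)] -/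
theorem isClassicalNSSolutionOn_pressurePotential
    {v : ℝ → (EuclideanSpace ℝ (Fin 3)) → (EuclideanSpace ℝ (Fin 3))}
    {q : ℝ → (EuclideanSpace ℝ (Fin 3)) → ℝ} {C : ℝ}
    (hsol : IsClassicalNSSolutionOn (Iio 0) 1 0 v q) (hdec : HasTypeIDecay C v)
    (hQs : IsSmoothSpaceTimeOn (Iio 0) (fun t x => pressurePotential (v t) x)) :
    IsClassicalNSSolutionOn (Iio 0) 1 0 v (fun t x => pressurePotential (v t) x) where
  smooth_velocity := hsol.smooth_velocity
  smooth_pressure := hQs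
  momentum t ht x := by
    have hm := hsol.momentum t ht x
    have hI : ∀ s ∈ Iio (0 : ℝ), ∀ y : EuclideanSpace ℝ (Fin 3),
        ‖v s y‖ ≤ C / (‖y - 0‖ + Real.sqrt (0 - s)) := fun s hs y => by
      rw [sub_zero, zero_sub]; exact hdec s hs y
    have hg : gradient (q t) x = gradient (pressurePotential (v t)) x :=
      PineauVicol2026.gradient_pressure_eq_of_typeI_vertex hsol hI ht x
    rw [hg] at hm
    exact hm
  divFree := hsol.divFree

/-- `‖∇f(x)‖ = ‖Df(x)‖` (the Riesz map is an isometry). [folklore] -/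
theorem norm_gradient_eq_norm_fderiv (f : (EuclideanSpace ℝ (Fin 3)) → ℝ) (x : EuclideanSpace ℝ (Fin 3)) :
    ‖gradient f x‖ = ‖fderiv ℝ f x‖ := by
  rw [gradient, LinearIsometryEquiv.norm_map]

/-- **Registered sub-goal `stub_apexScaleInvariantBounds_ofRieszSmooth`: the stub
`stub_apexScaleInvariantBounds` follows from the joint smoothness of the Riesz pressure.**  If for every
classical Type-I solution `(v, q)` of Navier–Stokes (`ν = 1`, `f = 0`) on `(−∞, 0) × ℝ³` the Riesz pressure
`(t, x) ↦ Q[v(t)](x)` (`pressurePotential (v t) x`) is jointly `C^∞` on `(−∞,0) × ℝ³`, then every such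
solution is classical with the pressure `q' = Q[v]`, which obeys, with ONE constant `K = K(C)`, the six
scale-invariant bounds of the stub: the pressure bounds are `apexRieszPressure_scaleInvariantBounds`
(`‖∇q'‖ = ‖DQ‖`, and the Hessian bound feeds `∇∂ₜv`), the rest is the landed
`stub_apexScaleInvariantBounds_ofPressure`. [cite: SereginSverak2009, §2 p. 8] -/
theorem stub_apexScaleInvariantBounds_ofRieszSmooth :
    (∀ (v : ℝ → EuclideanSpace ℝ (Fin 3) → EuclideanSpace ℝ (Fin 3)) (q : ℝ → EuclideanSpace ℝ (Fin 3) → ℝ) (C : ℝ), Literature.Analysis.FluidPDE.IsClassicalNSSolutionOn (Set.Iio 0) 1 0 v q → Literature.Analysis.FluidPDE.HasTypeIDecay C v → Literature.Analysis.FluidPDE.IsSmoothSpaceTimeOn (Set.Iio 0) (fun t x => Literature.Analysis.FluidPDE.pressurePotential (v t) x)) → ∀ (v : ℝ → EuclideanSpace ℝ (Fin 3) → EuclideanSpace ℝ (Fin 3)) (q : ℝ → EuclideanSpace ℝ (Fin 3) → ℝ) (C : ℝ), Literature.Analysis.FluidPDE.IsClassicalNSSolutionOn (Set.Iio 0) 1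 0 v q → Literature.Analysis.FluidPDE.HasTypeIDecay C v → ∃ (q' : ℝ → EuclideanSpace ℝ (Fin 3) → ℝ) (K : ℝ), Literature.Analysis.FluidPDE.IsClassicalNSSolutionOn (Set.Iio 0) 1 0 v q' ∧ ∀ t < (0 : ℝ), ∀ (x : EuclideanSpace ℝ (Fin 3)), (‖x‖ + Real.sqrt (-t)) ^ 2 * ‖fderiv ℝ (v t) x‖ ≤ K ∧ (‖x‖ + Real.sqrt (-t)) ^ 3 * ‖iteratedFDeriv ℝ 2 (v t) x‖ ≤ K ∧ (‖x‖ + Real.sqrt (-t)) ^ 2 * |q' t x| ≤ K ∧ (‖x‖ + Real.sqrt (-t)) ^ 3 * ‖gradient (q' t) x‖ ≤ K ∧ (‖x‖ + Real.sqrt (-t)) ^ 3 * ‖Literature.Analysis.FluidPDE.timeDeriv v t x‖ ≤ K ∧ (‖x‖ + Real.sqrt (-t)) ^ 4 * ‖fderiv ℝ (Literature.Analysis.FluidPDE.timeDeriv v t) x‖ ≤ K := by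
  intro hQs
  refine stub_apexScaleInvariantBounds_ofPressure ?_
  intro v q C hsol hdec
  obtain ⟨K, -, hK⟩ := apexRieszPressure_scaleInvariantBounds C
  refine ⟨fun t x => pressurePotential (v t) x, K,
    isClassicalNSSolutionOn_pressurePotential hsol hdec (hQs v q C hsol hdec), fun t ht x => ?_⟩
  obtain ⟨b0, b1, b2⟩ := hK v q hsol hdec t ht x
  refine ⟨b0, ?_, b2⟩
  show (‖x‖ + Real.sqrt (-t)) ^ 3 * ‖gradient (pressurePotential (v t)) x‖ ≤ K
  rw [norm_gradient_eq_norm_fderiv]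
  exact b1

/-! ### Reduction to the time regularity of the far potential at the origin -/

section FarReduction

open scoped Convolution

variable {v : ℝ → (EuclideanSpace ℝ (Fin 3)) → (EuclideanSpace ℝ (Fin 3))}
  {q : ℝ → (EuclideanSpace ℝ (Fin 3)) → ℝ} {C : ℝ}

/-- **The Riesz pressure differs from any classical pressure by a function of time**: for a classical
Type-I solution `(v, q)` on the past, `Q[v(t)](x) = q(t,x) − q(t,0) + Q[v(t)](0)` for `t < 0`
(`∇q(t) = ∇Q[v(t)]`, `PineauVicol2026.gradient_pressure_eq_of_typeI_vertex`, and a function with zero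
derivative is constant). [cite: PineauVicol2026, Lemma 2.1 and Lemma 7.1 (proofs, pp. 9–10 and 23–24)] -/
theorem pressurePotential_eq_pressure_sub (hsol : IsClassicalNSSolutionOn (Iio 0) 1 0 v q)
    (hdec : HasTypeIDecay C v) {t : ℝ} (ht : t < 0) (x : EuclideanSpace ℝ (Fin 3)) :
    pressurePotential (v t) x = q t x - q t 0 + pressurePotential (v t) 0 := by
  have hI : ∀ s ∈ Iio (0 : ℝ), ∀ y : EuclideanSpace ℝ (Fin 3),
      ‖v s y‖ ≤ C / (‖y - 0‖ + Real.sqrt (0 - s)) := fun s hs y => by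
    rw [sub_zero, zero_sub]; exact hdec s hs y
  -- the slice is `C⁴` and in a decay class, so `Q[v(t)] ∈ C²`
  have hv4 : ContDiff ℝ 4 (v t) := (hsol.contDiff_velocity ht).of_le (by norm_cast)
  have hσ0 : 0 < Real.sqrt (-t) := Real.sqrt_pos.2 (by linarith)
  have hv' : ∀ z, ‖v t z‖ ≤ C / (‖z - 0‖ + Real.sqrt (-t)) := fun z => by
    rw [sub_zero]; exact hdec t ht z
  have hWd := fun z => PineauVicol2026.decay_of_profile hσ0 hv' z
  have hQ2 : ContDiff ℝ 2 (pressurePotential (v t)) := PineauVicol2026.contDiff_pressurePotential_decay hv4 hWd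
  have hq1 : ContDiff ℝ 1 (q t) := (hsol.contDiff_pressure ht).of_le (by norm_cast)
  have hdiff : Differentiable ℝ fun ξ => q t ξ - pressurePotential (v t) ξ :=
    (hq1.differentiable one_ne_zero).sub (hQ2.differentiable two_ne_zero)
  have hzero : ∀ ξ, fderiv ℝ (fun ξ => q t ξ - pressurePotential (v t) ξ) ξ = 0 := by
    intro ξ
    have hg := PineauVicol2026.gradient_pressure_eq_of_typeI_vertex hsol hI ht ξ
    rw [gradient, gradient] at hg
    have hfd : fderiv ℝ (q t) ξ = fderiv ℝ (pressurePotential (v t)) ξ :=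
      (InnerProductSpace.toDual ℝ (EuclideanSpace ℝ (Fin 3))).symm.injective hg
    rw [fderiv_fun_sub ((hq1.differentiable one_ne_zero) ξ) ((hQ2.differentiable two_ne_zero) ξ), hfd,
      sub_self]
  have hconst := is_const_of_fderiv_eq_zero hdiff hzero x 0
  linarith

/-- **The near potential at the origin is smooth in time**: `t ↦ Q₁[v(t)](0) = ∫ Γ₀(z) G[v(t)](−z) dz`
is `C^∞` on `(−∞, 0)` for a jointly smooth `v` (Mathlib's `contDiffOn_convolution_right_with_param_comp`:
the locally integrable kernel `Γ₀` convolved with the jointly smooth source `G[v(t)]`, localised by a bump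
function `χ ≡ 1` on the support of `Γ₀`). [folklore] -/
theorem contDiffOn_nearPotential_zero (hv : IsSmoothSpaceTimeOn (Iio 0) v) :
    ContDiffOn ℝ ∞ (fun t => nearPotential 1 2 (v t) 0) (Iio 0) := by
  -- the bump `χ ≡ 1` on `B̄(0,2)`, supported in `B̄(0,3)`
  let χ : ContDiffBump (0 : EuclideanSpace ℝ (Fin 3)) := ⟨2, 3, by norm_num, by norm_num⟩
  set g : ℝ → (EuclideanSpace ℝ (Fin 3)) → ℝ := fun t z => χ z * pressureSource (v t) z with hg
  have hk : IsCompact (closedBall (0 : EuclideanSpace ℝ (Fin 3)) 3) := isCompact_closedBall 0 3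
  have hgs : ∀ (p : ℝ) (x : EuclideanSpace ℝ (Fin 3)), p ∈ Iio (0 : ℝ) →
      x ∉ closedBall (0 : EuclideanSpace ℝ (Fin 3)) 3 → g p x = 0 := by
    intro p x _ hx
    have h3 : χ.rOut ≤ dist x 0 := by
      rw [mem_closedBall, not_le] at hx; exact hx.le
    simp only [hg, χ.zero_of_le_dist h3, zero_mul]
  have hf : LocallyIntegrable (newtonNear (1 : ℝ) 2) (volume : Measure (EuclideanSpace ℝ (Fin 3))) :=
    (integrable_newtonNear zero_le_one one_lt_two).locallyIntegrable
  have hG : IsSmoothSpaceTimeOn (Iio 0) (fun t y => pressureSource (v t) y) :=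
    hv.pressureSource (uniqueDiffOn_Iio 0)
  have hgc : ContDiffOn ℝ ∞ (↿g) (Iio (0 : ℝ) ×ˢ (univ : Set (EuclideanSpace ℝ (Fin 3)))) := by
    have h1 : ContDiffOn ℝ ∞ (fun p : ℝ × EuclideanSpace ℝ (Fin 3) => χ p.2)
        (Iio (0 : ℝ) ×ˢ (univ : Set (EuclideanSpace ℝ (Fin 3)))) :=
      (χ.contDiff.comp contDiff_snd).contDiffOn
    exact h1.mul hG
  have hconv := contDiffOn_convolution_right_with_param_comp (𝕜 := ℝ) (μ := (volume : Measure (EuclideanSpace ℝ (Fin 3))))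
    (ContinuousLinearMap.mul ℝ ℝ) (v := fun _ : ℝ => (0 : EuclideanSpace ℝ (Fin 3))) contDiffOn_const
    isOpen_Iio hk hgs hf hgc
  refine hconv.congr fun t _ => ?_
  -- identify the convolution at `0` with the near potential
  rw [convolution_def, nearPotential]
  refine integral_congr_ae (Eventually.of_forall fun z => ?_)
  simp only [ContinuousLinearMap.mul_apply', hg, zero_sub]
  by_cases hz : ‖z‖ ≤ 2
  · have h1 : χ (-z) = 1 := χ.one_of_mem_closedBall (by
      rw [mem_closedBall, dist_zero_right, norm_neg]; exact hz)
    rw [h1, one_mul]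
  · rw [newtonNear_eq_zero zero_le_one one_lt_two (not_le.1 hz).le, zero_mul, zero_mul]

/-- **Joint smoothness of the Riesz pressure from the time regularity of the far potential at the
origin.**  If `t ↦ Q₂[v(t)](0)` is `C^∞` on `(−∞,0)` then `(t, x) ↦ Q[v(t)](x)` is jointly `C^∞` there:
`Q[v(t)](x) = q(t,x) − q(t,0) − Q₁[v(t)](0) − Q₂[v(t)](0)` (`pressurePotential_eq_pressure_sub`) with `q`
jointly smooth and `Q₁[v(·)](0)` smooth (`contDiffOn_nearPotential_zero`). [folklore] -/
theorem isSmoothSpaceTimeOn_pressurePotential_of_far (hsol : IsClassicalNSSolutionOn (Iio 0) 1 0 v q)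
    (hdec : HasTypeIDecay C v) (hfar : ContDiffOn ℝ ∞ (fun t => farPotential 1 2 (v t) 0) (Iio 0)) :
    IsSmoothSpaceTimeOn (Iio 0) (fun t x => pressurePotential (v t) x) := by
  have hq : ContDiffOn ℝ ∞ (uncurry q) (Iio (0 : ℝ) ×ˢ (univ : Set (EuclideanSpace ℝ (Fin 3)))) :=
    hsol.smooth_pressure
  have hnear := contDiffOn_nearPotential_zero hsol.smooth_velocity
  have hmaps1 : MapsTo (fun p : ℝ × EuclideanSpace ℝ (Fin 3) => (p.1, (0 : EuclideanSpace ℝ (Fin 3))))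
      (Iio (0 : ℝ) ×ˢ (univ : Set (EuclideanSpace ℝ (Fin 3)))) (Iio (0 : ℝ) ×ˢ univ) :=
    fun p hp => mk_mem_prod (mem_prod.1 hp).1 (mem_univ _)
  have hmaps2 : MapsTo (fun p : ℝ × EuclideanSpace ℝ (Fin 3) => p.1)
      (Iio (0 : ℝ) ×ˢ (univ : Set (EuclideanSpace ℝ (Fin 3)))) (Iio (0 : ℝ)) :=
    fun p hp => (mem_prod.1 hp).1
  have h0 : ContDiffOn ℝ ∞ (fun p : ℝ × EuclideanSpace ℝ (Fin 3) => q p.1 0)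
      (Iio (0 : ℝ) ×ˢ (univ : Set (EuclideanSpace ℝ (Fin 3)))) :=
    hq.comp (contDiffOn_fst.prodMk contDiffOn_const) hmaps1
  have h1 : ContDiffOn ℝ ∞ (fun p : ℝ × EuclideanSpace ℝ (Fin 3) => nearPotential 1 2 (v p.1) 0)
      (Iio (0 : ℝ) ×ˢ (univ : Set (EuclideanSpace ℝ (Fin 3)))) := hnear.comp contDiffOn_fst hmaps2
  have h2 : ContDiffOn ℝ ∞ (fun p : ℝ × EuclideanSpace ℝ (Fin 3) => farPotential 1 2 (v p.1) 0)
      (Iio (0 : ℝ) ×ˢ (univ : Set (EuclideanSpace ℝ (Fin 3)))) := hfar.comp contDiffOn_fst hmaps2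
  have hF : ContDiffOn ℝ ∞ (fun p : ℝ × EuclideanSpace ℝ (Fin 3) =>
      uncurry q p - q p.1 0 + (-nearPotential 1 2 (v p.1) 0 - farPotential 1 2 (v p.1) 0))
      (Iio (0 : ℝ) ×ˢ (univ : Set (EuclideanSpace ℝ (Fin 3)))) := (hq.sub h0).add (h1.neg.sub h2)
  refine hF.congr ?_
  rintro ⟨t, x⟩ hp
  have ht : t < 0 := (mem_prod.1 hp).1
  show pressurePotential (v t) x = q t x - q t 0 + (-nearPotential 1 2 (v t) 0 - farPotential 1 2 (v t) 0)
  rw [pressurePotential_eq_pressure_sub hsol hdec ht x, pressurePotential]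

/-- **Registered sub-goal `stub_apexScaleInvariantBounds_ofFarSmooth`: the stub from the time regularity
of ONE parametric integral.**  If for every classical Type-I solution `(v, q)` of Navier–Stokes
(`ν = 1`, `f = 0`) on `(−∞,0) × ℝ³` the far potential at the origin,
`t ↦ Q₂[v(t)](0) = ∫ D²Γ∞^{1,2}(−y)(v(t,y), v(t,y)) dy`, is `C^∞` on `(−∞, 0)`, then the stub
`stub_apexScaleInvariantBounds` holds (`isSmoothSpaceTimeOn_pressurePotential_of_far` and
`stub_apexScaleInvariantBounds_ofRieszSmooth`).  This residual hypothesis is where the decay at spatial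
infinity of the TIME derivatives of `v` enters (differentiation under the integral sign against the
non-integrable kernel `D²Γ∞ = O(|y|⁻³)`). [cite: SereginSverak2009, §2 p. 8] -/
theorem stub_apexScaleInvariantBounds_ofFarSmooth :
    (∀ (v : ℝ → EuclideanSpace ℝ (Fin 3) → EuclideanSpace ℝ (Fin 3)) (q : ℝ → EuclideanSpace ℝ (Fin 3) → ℝ) (C : ℝ), Literature.Analysis.FluidPDE.IsClassicalNSSolutionOn (Set.Iio 0) 1 0 v q → Literature.Analysis.FluidPDE.HasTypeIDecay C v → ContDiffOn ℝ ∞ (fun t => Literature.Analysis.FluidPDE.farPotential 1 2 (v t) 0) (Set.Iio 0)) → ∀ (v : ℝ → EuclideanSpace ℝ (Fin 3) → EuclideanSpace ℝ (Fin 3)) (q : ℝ → EuclideanSpace ℝ (Fin 3) → ℝ) (C : ℝ), Literature.Analysis.FluidPDE.IsClassicalNSSolutionOn (Set.Iio 0) 1 0 v q → Literature.Analysis.FluidPDE.HasTypeIDecay C v → ∃ (q' : ℝ → EuclideanSpace ℝ (Fin 3) → ℝ) (K : ℝ), Literature.Analysis.FluidPDE.IsClassicalNSSolutionOn (Set.Iio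 0) 1 0 v q' ∧ ∀ t < (0 : ℝ), ∀ (x : EuclideanSpace ℝ (Fin 3)), (‖x‖ + Real.sqrt (-t)) ^ 2 * ‖fderiv ℝ (v t) x‖ ≤ K ∧ (‖x‖ + Real.sqrt (-t)) ^ 3 * ‖iteratedFDeriv ℝ 2 (v t) x‖ ≤ K ∧ (‖x‖ + Real.sqrt (-t)) ^ 2 * |q' t x| ≤ K ∧ (‖x‖ + Real.sqrt (-t)) ^ 3 * ‖gradient (q' t) x‖ ≤ K ∧ (‖x‖ + Real.sqrt (-t)) ^ 3 * ‖Literature.Analysis.FluidPDE.timeDeriv v t x‖ ≤ K ∧ (‖x‖ + Real.sqrt (-t)) ^ 4 * ‖fderiv ℝ (Literature.Analysis.FluidPDE.timeDeriv v t) x‖ ≤ K :=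
  fun hfar => stub_apexScaleInvariantBounds_ofRieszSmooth fun v q C hsol hdec =>
    isSmoothSpaceTimeOn_pressurePotential_of_far hsol hdec (hfar v q C hsol hdec)

end FarReduction

end Summit.NavierStokesRegularity.NavierStokesRegularity.Theorems.SymmetricScarExists.LogtimeBernoulli
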